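import Mathlib.Analysis.Calculus.FDeriv.Mul
import Mathlib.Analysis.Calculus.FDeriv.Add
import Literature.AlgebraicGeometry.Motives.AbelianVarietyCotangent
import Literature.Geometry.Kaehler.ComplexTorusHolomorphicMaps
import Literature.NumberTheory.Transcendental.AnalytificationFunctorialityProofs
import Literature.NumberTheory.Transcendental.AnalytificationRationalCotangentFrame
import HarnessLib

/-!
# The differential at the origin: `T_e^*(B) = 𝔪_e/𝔪_e² ≅ E^*` along an analytification of a complex abelian variety

Family `hodge`, layer `Literature/AlgebraicGeometry/HodgeTheory`.  THEOREMS ONLY (no definition, no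
named fact).  TRACK 2 of TEAM hCMisogE (the proof of the named fact `cotangent_hodge10_comparison`),
files (T2-0) and (T2-a/b) of `HOME/pinning/hcmisog/NAMES-T2.md`.

Let `B` be a complex abelian variety of the tree (`Motives.AbelianVariety ℂ`) and `φ : M → B(ℂ)` an
analytification of `B` by a complex manifold `M` modelled on `E` (`Transcendental.IsAnalytification`),
`P ∈ M` a point over the origin `e`.  Reading a regular function `s ∈ Γ(B, U)`, `U ∋ e`, in the chart
`χ` of `M` at `P` gives a holomorphic function `z ↦ s(φ(χ⁻¹ z))` near `χ P`
(`IsAnalytification.hasFDerivAt_evalOrZero_chart`); its differential at `χ P` depends only on the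
germ of `s` at `e`, is additive and satisfies the Leibniz rule, hence kills `𝔪_e²` and the constants:
this is the **differential at the origin** `d_e : 𝔪_e/𝔪_e² → E^* = Hom_ℂ(E, ℂ)` on the ALGEBRAIC
cotangent space `Motives.AbelianVariety.Cotangent B` of the tree ((L1a), Görtz–Wedhorn II Def. 27.17).
By GAGA at a point (`IsAnalytification.exists_rational_cotangentFrame`: the differentials of regular
functions span `E^*`; Serre, GAGA §2 n°6 Prop. 3 Cor. 2) it is onto, and `dim 𝔪_e/𝔪_e² = dim B = dim E`
(`Motives.AbelianVariety.finrank_cotangent`, `IsAnalytification.finrank_eq`) makes it an isomorphism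
(Lange–Birkenhake §1.1.5: «the complex cotangent space `Ω¹_{X,0}` of `X` at `0` is `Ω := Hom_ℂ(V, ℂ)`»;
Shimura 1998 §2.6 Prop. 3: `𝔇₀(G) = 𝔇₀(G;k) ⊗_k Ω`, an invariant form is its value at `e`).

* `IsAnalytification.exists_stalkDifferential` — the differential on the stalk `𝒪_{B,e}` (additive,
  well defined on germs).
* `Motives.AbelianVariety.exists_cotangentDifferential_of_isAnalytification` — **the isomorphism
  `Ψ₀ : T_e^*(B) ≃ₗ[ℂ] (E →L[ℂ] ℂ)` characterised by `Ψ₀ (d s) = D(s ∘ φ ∘ χ⁻¹)(χ P)`**.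
* `Motives.AbelianVariety.analyticRep_of_hom` (T2-0) — for the torus uniformisation
  `φ : ComplexTorus Φ → B(ℂ)` of the tree and an endomorphism `g` of `B`: `φ⁻¹ ∘ g(ℂ) ∘ φ` is the
  homomorphism `mapMatrix A` of an integer matrix with a `ℂ`-LINEAR analytic representation `L`
  (GAGA functoriality `IsAnalytification.mdifferentiable_comp_map_holds` + Lange–Birkenhake
  Prop. 1.1.6 `ComplexTorus.exists_eq_mapMatrix_of_map_zero`).
* `Motives.AbelianVariety.exists_cotangentDifferential` — the torus form consumed by (T2-c)/(T2-e).

## References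

* [LangeBirkenhake1992] H. Lange, Ch. Birkenhake, *Complex Abelian Varieties* (1992), §1.1.2
  Prop. 1.1.6, Cor. 1.1.7; §1.1.5 (before Lemma 1.1.22).
* [SerreGAGA1956] J.-P. Serre, *Géométrie algébrique et géométrie analytique* (1956), §2 n°5 Prop. 2,
  n°6 Prop. 3 Cor. 2.
* [Shimura1998] G. Shimura, *Abelian Varieties with Complex Multiplication and Modular Functions*
  (1998), §2.6 Prop. 3.
* [GortzWedhorn2023] U. Görtz, T. Wedhorn, *Algebraic Geometry II* (2023), Def. 27.17, Rem. 27.18.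

## Provenance

pub-hodgecm2 TEAM hCMisogE TRACK 2 (seat `hcmisog-lie-2`; lead GO 2026-08-21 l.5275).  HC_CM is NOT
proved; nothing here is specific to it.
-/

noncomputable section

universe u

open CategoryTheory AlgebraicGeometry Topology Filter TopologicalSpace
open scoped Manifold ContDiff
open Literature.AlgebraicGeometry.Motives (AlgPoints ComplexPoints SchemeOver AbelianVariety)
open Literature.AlgebraicGeometry.Motives.AlgPoints
open Literature.Geometry.Kaehler (ComplexTorus)

namespace Literature.AlgebraicGeometry.HodgeTheory

open Literature.NumberTheory.Transcendental
open Literature.NumberTheory.Transcendental.IsAnalytification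

/-! ### §1  The differential of a germ along an analytification (general smooth `ℂ`-scheme) -/

section StalkDifferential

variable {E : Type*} [NormedAddCommGroup E] [NormedSpace ℂ E] [FiniteDimensional ℂ E]
  {M : Type*} [TopologicalSpace M] [ChartedSpace E M] [IsManifold 𝓘(ℂ, E) ω M]
  {Y : SchemeOver ℂ} {d : ℕ} {φ : M → ComplexPoints Y}

/-- `evalOrZero U` is additive, pointwise. [folklore] -/
private theorem evalOrZero_add_pointwise (U : Y.left.Opens) (s t : Γ(Y.left, U)) (Q : ComplexPoints Y) :
    evalOrZero U (s + t) Q = evalOrZero U s Q + evalOrZero U t Q := by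
  by_cases hQ : Q.pt ∈ U
  · simp only [evalOrZero_of_mem _ hQ, ← AlgPoints.evalRingHom_apply, _root_.map_add]
  · simp only [evalOrZero_of_not_mem _ hQ, add_zero]

/-- `evalOrZero U` is multiplicative, pointwise. [folklore] -/
private theorem evalOrZero_mul_pointwise (U : Y.left.Opens) (s t : Γ(Y.left, U)) (Q : ComplexPoints Y) :
    evalOrZero U (s * t) Q = evalOrZero U s Q * evalOrZero U t Q := by
  by_cases hQ : Q.pt ∈ U
  · simp only [evalOrZero_of_mem _ hQ, ← AlgPoints.evalRingHom_apply, _root_.map_mul]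
  · simp only [evalOrZero_of_not_mem _ hQ, mul_zero]

omit [IsManifold 𝓘(ℂ, E) ω M] in
/-- Two sections with the same germ at `pt(φ P)` define, read through `φ` in the chart at `P`, the
same function near `χ P`. [cite: SerreGAGA1956, §2 n°5 Prop. 2] -/
theorem _root_.Literature.NumberTheory.Transcendental.IsAnalytification.evalOrZero_chart_eventuallyEq_of_germ_eq (hφ : IsAnalytification E Y d φ) (P : M)
    {U V : Y.left.Opens} (hU : (φ P).pt ∈ U) (hV : (φ P).pt ∈ V) (s : Γ(Y.left, U))
    (t : Γ(Y.left, V))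
    (h : Y.left.presheaf.germ U _ hU s = Y.left.presheaf.germ V _ hV t) :
    (fun z ↦ evalOrZero U s (φ ((chartAt E P).symm z))) =ᶠ[𝓝 (chartAt E P P)]
      fun z ↦ evalOrZero V t (φ ((chartAt E P).symm z)) := by
  obtain ⟨W, hW, iU, iV, hst⟩ := TopCat.Presheaf.germ_eq _ _ hU hV s t h
  -- the chart parameters over `W(ℂ)` form a neighbourhood of `χ P`
  have hnhds : (chartAt E P).target ∩ (chartAt E P).symm ⁻¹' (φ ⁻¹' {R | R.pt ∈ W}) ∈
      𝓝 (chartAt E P P) := by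
    refine ((chartAt E P).isOpen_inter_preimage_symm (hφ.isOpen_preimage W)).mem_nhds ⟨?_, ?_⟩
    · exact (chartAt E P).map_source (mem_chart_source E P)
    · show φ ((chartAt E P).symm (chartAt E P P)) ∈ {R | R.pt ∈ W}
      rw [(chartAt E P).left_inv (mem_chart_source E P)]
      exact hW
  filter_upwards [hnhds] with z hz
  have hzW : (φ ((chartAt E P).symm z)).pt ∈ W := hz.2
  rw [evalOrZero_of_mem s (iU.le hzW), evalOrZero_of_mem t (iV.le hzW),
    ← AlgPoints.eval_res _ iU.le hzW s, ← AlgPoints.eval_res _ iV.le hzW t]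
  exact congrArg _ hst

/-- **The differential of a germ.**  For an analytification `φ : M → Y(ℂ)` with holomorphic atlas
and `P ∈ M`, there is a map `D` on the stalk `𝒪_{Y, pt(φ P)}` such that `D` of the germ of
`s ∈ Γ(Y, U)` is the differential at `χ P` of `z ↦ s(φ(χ⁻¹ z))` (`χ` the chart at `P`); it is
additive. [cite: SerreGAGA1956, §2 n°5 Prop. 2] -/
theorem _root_.Literature.NumberTheory.Transcendental.IsAnalytification.exists_stalkDifferential (hφ : IsAnalytification E Y d φ) (P : M) :
    ∃ D : Y.left.presheaf.stalk (φ P).pt →+ (E →L[ℂ] ℂ),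
      ∀ (U : Y.left.Opens) (hU : (φ P).pt ∈ U) (s : Γ(Y.left, U)),
        D (Y.left.presheaf.germ U _ hU s) =
          fderiv ℂ (fun z ↦ evalOrZero U s (φ ((chartAt E P).symm z))) (chartAt E P P) := by
  classical
  -- the value on a stalk element, through a chosen representative
  let rep : ∀ t : Y.left.presheaf.stalk (φ P).pt,
      Σ' (U : Y.left.Opens) (_ : (φ P).pt ∈ U), Γ(Y.left, U) := fun t ↦
    ⟨(Y.left.presheaf.exists_germ_eq t).choose,
      (Y.left.presheaf.exists_germ_eq t).choose_spec.choose,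
      (Y.left.presheaf.exists_germ_eq t).choose_spec.choose_spec.choose⟩
  have hrep : ∀ t, Y.left.presheaf.germ (rep t).1 _ (rep t).2.1 (rep t).2.2 = t := fun t ↦
    (Y.left.presheaf.exists_germ_eq t).choose_spec.choose_spec.choose_spec
  let D₀ : Y.left.presheaf.stalk (φ P).pt → (E →L[ℂ] ℂ) := fun t ↦
    fderiv ℂ (fun z ↦ evalOrZero (rep t).1 (rep t).2.2 (φ ((chartAt E P).symm z))) (chartAt E P P)
  -- `D₀` on a germ
  have hD₀ : ∀ (U : Y.left.Opens) (hU : (φ P).pt ∈ U) (s : Γ(Y.left, U)),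
      D₀ (Y.left.presheaf.germ U _ hU s) =
        fderiv ℂ (fun z ↦ evalOrZero U s (φ ((chartAt E P).symm z))) (chartAt E P P) := by
    intro U hU s
    exact (evalOrZero_chart_eventuallyEq_of_germ_eq hφ P (rep _).2.1 hU (rep _).2.2 s
      (hrep _)).fderiv_eq
  refine ⟨{ toFun := D₀, map_zero' := ?_, map_add' := ?_ }, hD₀⟩
  · -- `0` is the germ of the zero section
    have h0 : (0 : Y.left.presheaf.stalk (φ P).pt) = Y.left.presheaf.germ ⊤ _ trivial 0 := by
      rw [map_zero]
    rw [h0, hD₀]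
    have : (fun z : E ↦ evalOrZero (⊤ : Y.left.Opens) (0 : Γ(Y.left, ⊤))
        (φ ((chartAt E P).symm z))) = fun _ ↦ 0 := by
      funext z
      rw [evalOrZero_of_mem (0 : Γ(Y.left, ⊤))
        (show (φ ((chartAt E P).symm z)).pt ∈ (⊤ : Y.left.Opens) from trivial),
        ← AlgPoints.evalRingHom_apply, map_zero]
    rw [this]
    simp
  · intro t₁ t₂
    -- common open for the two germs
    obtain ⟨U, hU, s, rfl⟩ := Y.left.presheaf.exists_germ_eq t₁
    obtain ⟨V, hV, t, rfl⟩ := Y.left.presheaf.exists_germ_eq t₂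
    have hs : Y.left.presheaf.germ U _ hU s =
        Y.left.presheaf.germ (U ⊓ V) _ ⟨hU, hV⟩ (Y.left.presheaf.map (homOfLE inf_le_left).op s) := by
      rw [TopCat.Presheaf.germ_res_apply]
    have ht : Y.left.presheaf.germ V _ hV t =
        Y.left.presheaf.germ (U ⊓ V) _ ⟨hU, hV⟩ (Y.left.presheaf.map (homOfLE inf_le_right).op t) := by
      rw [TopCat.Presheaf.germ_res_apply]
    rw [hs, ht, ← map_add, hD₀, hD₀, hD₀]
    have hPUV : (φ P).pt ∈ U ⊓ V := ⟨hU, hV⟩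
    have h1 := hasFDerivAt_evalOrZero_chart hφ P (U ⊓ V)
      (Y.left.presheaf.map (homOfLE inf_le_left).op s) hPUV
    have h2 := hasFDerivAt_evalOrZero_chart hφ P (U ⊓ V)
      (Y.left.presheaf.map (homOfLE inf_le_right).op t) hPUV
    have hsum := h1.add h2
    rw [← hsum.fderiv]
    congr 1
    funext z
    exact evalOrZero_add_pointwise _ _ _ _

omit [IsManifold 𝓘(ℂ, E) ω M] in
/-- The chart parameters over `U(ℂ)` form a neighbourhood of `χ P` when `pt(φ P) ∈ U`. [folklore] -/
private theorem chart_preimage_mem_nhds' (hφ : IsAnalytification E Y d φ) (P : M) (U : Y.left.Opens)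
    (hPU : (φ P).pt ∈ U) :
    (chartAt E P).target ∩ (chartAt E P).symm ⁻¹' (φ ⁻¹' {R | R.pt ∈ U}) ∈ 𝓝 (chartAt E P P) := by
  refine ((chartAt E P).isOpen_inter_preimage_symm (hφ.isOpen_preimage U)).mem_nhds ⟨?_, ?_⟩
  · exact (chartAt E P).map_source (mem_chart_source E P)
  · show φ ((chartAt E P).symm (chartAt E P P)) ∈ {R | R.pt ∈ U}
    rw [(chartAt E P).left_inv (mem_chart_source E P)]
    exact hPU

omit [IsManifold 𝓘(ℂ, E) ω M] [FiniteDimensional ℂ E] [TopologicalSpace M] in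
/-- **A germ lies in the maximal ideal iff the function vanishes at the point** (Mathlib
`Scheme.mem_basicOpen` / `evaluation`, pushed to `L`-points by `AlgPoints.pt_mem_basicOpen_iff`).
[cite: SerreGAGA1956, §2 n°5 Prop. 2] -/
theorem _root_.Literature.NumberTheory.Transcendental.IsAnalytification.germ_mem_maximalIdeal_iff (P : M) {x : Y.left} (hx : (φ P).pt = x)
    {U : Y.left.Opens} (hU : x ∈ U) (s : Γ(Y.left, U)) :
    Y.left.presheaf.germ U x hU s ∈ IsLocalRing.maximalIdeal (Y.left.presheaf.stalk x) ↔
      evalOrZero U s (φ P) = 0 := by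
  subst hx
  rw [IsLocalRing.mem_maximalIdeal, mem_nonunits_iff, ← Scheme.mem_basicOpen,
    AlgPoints.pt_mem_basicOpen_iff (φ P) hU s, not_not, evalOrZero_of_mem s hU]

omit [IsManifold 𝓘(ℂ, E) ω M] [FiniteDimensional ℂ E] [ChartedSpace E M] [TopologicalSpace M]
  [NormedSpace ℂ E] [NormedAddCommGroup E] in
/-- The constant `c`, restricted to `U`, takes the value `c` on `U(ℂ)`. [folklore] -/
private theorem evalOrZero_const_res (U : Y.left.Opens) (c : ℂ) {Q : ComplexPoints Y} (hQ : Q.pt ∈ U) :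
    evalOrZero U (Y.left.presheaf.map (homOfLE le_top).op
      (Y.hom.appTop ((Scheme.ΓSpecIso (.of ℂ)).inv c))) Q = c := by
  rw [evalOrZero_of_mem _ hQ, AlgPoints.eval_res Q le_top hQ]
  have h := AlgPoints.eval_appLE_top Q (U := Y.hom ⁻¹ᵁ ⊤) trivial le_rfl
    ((Scheme.ΓSpecIso (.of ℂ)).inv c)
  rw [Iso.inv_hom_id_apply, ← Scheme.Hom.app_eq_appLE, Algebra.algebraMap_self, RingHom.id_apply] at h
  exact h

/-- `exists_stalkDifferential` at a point `x = pt(φ P)` given propositionally. [cite: SerreGAGA1956, §2 n°5 Prop. 2] -/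
theorem _root_.Literature.NumberTheory.Transcendental.IsAnalytification.exists_stalkDifferential_of_eq (hφ : IsAnalytification E Y d φ) (P : M) {x : Y.left}
    (hx : (φ P).pt = x) :
    ∃ D : Y.left.presheaf.stalk x →+ (E →L[ℂ] ℂ),
      ∀ (U : Y.left.Opens) (hU : x ∈ U) (s : Γ(Y.left, U)),
        D (Y.left.presheaf.germ U x hU s) =
          fderiv ℂ (fun z ↦ evalOrZero U s (φ ((chartAt E P).symm z))) (chartAt E P P) := by
  subst hx
  exact exists_stalkDifferential hφ P

/-- **Product rule at a zero**: the differential of the germ of `s · t` vanishes when `s` and `t`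
vanish at the point. [cite: SerreGAGA1956, §2 n°5 Prop. 2] -/
theorem _root_.Literature.NumberTheory.Transcendental.IsAnalytification.stalkDifferential_mul_eq_zero (hφ : IsAnalytification E Y d φ) (P : M) {x : Y.left}
    (hx : (φ P).pt = x) (D : Y.left.presheaf.stalk x →+ (E →L[ℂ] ℂ))
    (hD : ∀ (U : Y.left.Opens) (hU : x ∈ U) (s : Γ(Y.left, U)),
      D (Y.left.presheaf.germ U x hU s) =
        fderiv ℂ (fun z ↦ evalOrZero U s (φ ((chartAt E P).symm z))) (chartAt E P P))
    {a b : Y.left.presheaf.stalk x}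
    (ha : a ∈ IsLocalRing.maximalIdeal (Y.left.presheaf.stalk x))
    (hb : b ∈ IsLocalRing.maximalIdeal (Y.left.presheaf.stalk x)) : D (a * b) = 0 := by
  subst hx
  obtain ⟨U, hU, s, rfl⟩ := Y.left.presheaf.exists_germ_eq a
  obtain ⟨V, hV, t, rfl⟩ := Y.left.presheaf.exists_germ_eq b
  have hPUV : (φ P).pt ∈ U ⊓ V := ⟨hU, hV⟩
  set s' := Y.left.presheaf.map (homOfLE (inf_le_left : U ⊓ V ≤ U)).op s with hs'
  set t' := Y.left.presheaf.map (homOfLE (inf_le_right : U ⊓ V ≤ V)).op t with ht'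
  have hs : Y.left.presheaf.germ U _ hU s = Y.left.presheaf.germ (U ⊓ V) _ hPUV s' := by
    rw [hs', TopCat.Presheaf.germ_res_apply]
  have ht : Y.left.presheaf.germ V _ hV t = Y.left.presheaf.germ (U ⊓ V) _ hPUV t' := by
    rw [ht', TopCat.Presheaf.germ_res_apply]
  rw [hs] at ha ⊢
  rw [ht] at hb ⊢
  rw [← _root_.map_mul, hD]
  have h1 := hasFDerivAt_evalOrZero_chart hφ P (U ⊓ V) s' hPUV
  have h2 := hasFDerivAt_evalOrZero_chart hφ P (U ⊓ V) t' hPUV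
  have hmul := h1.mul h2
  have hfun : (fun z ↦ evalOrZero (U ⊓ V) (s' * t') (φ ((chartAt E P).symm z))) = fun z ↦
      evalOrZero (U ⊓ V) s' (φ ((chartAt E P).symm z)) *
        evalOrZero (U ⊓ V) t' (φ ((chartAt E P).symm z)) :=
    funext fun z ↦ evalOrZero_mul_pointwise _ _ _ _
  have hmul' : HasFDerivAt (fun z ↦ evalOrZero (U ⊓ V) s' (φ ((chartAt E P).symm z)) *
      evalOrZero (U ⊓ V) t' (φ ((chartAt E P).symm z))) _ (chartAt E P P) := hmul
  rw [hfun, hmul'.fderiv, (chartAt E P).left_inv (mem_chart_source E P),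
    (germ_mem_maximalIdeal_iff P rfl hPUV s').1 ha, (germ_mem_maximalIdeal_iff P rfl hPUV t').1 hb]
  ext v
  simp

/-- **Constants scale the differential**: `D (c · a) = c • D a` for the constant germ `c ∈ ℂ`
(pulled back from `Spec ℂ`). [cite: SerreGAGA1956, §2 n°5 Prop. 2] -/
theorem _root_.Literature.NumberTheory.Transcendental.IsAnalytification.stalkDifferential_const_mul (hφ : IsAnalytification E Y d φ) (P : M) {x : Y.left}
    (hx : (φ P).pt = x) (D : Y.left.presheaf.stalk x →+ (E →L[ℂ] ℂ))
    (hD : ∀ (U : Y.left.Opens) (hU : x ∈ U) (s : Γ(Y.left, U)),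
      D (Y.left.presheaf.germ U x hU s) =
        fderiv ℂ (fun z ↦ evalOrZero U s (φ ((chartAt E P).symm z))) (chartAt E P P))
    (c : ℂ) (a : Y.left.presheaf.stalk x) :
    D (Y.left.presheaf.germ ⊤ x trivial (Y.hom.appTop ((Scheme.ΓSpecIso (.of ℂ)).inv c)) * a) =
      c • D a := by
  subst hx
  obtain ⟨U, hU, s, rfl⟩ := Y.left.presheaf.exists_germ_eq a
  set κ := Y.left.presheaf.map (homOfLE (le_top : U ≤ ⊤)).op
    (Y.hom.appTop ((Scheme.ΓSpecIso (.of ℂ)).inv c)) with hκ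
  have hκg : Y.left.presheaf.germ ⊤ _ trivial (Y.hom.appTop ((Scheme.ΓSpecIso (.of ℂ)).inv c)) =
      Y.left.presheaf.germ U _ hU κ := by
    rw [hκ, TopCat.Presheaf.germ_res_apply]
  rw [hκg, ← _root_.map_mul, hD, hD]
  have hfun : (fun z ↦ evalOrZero U (κ * s) (φ ((chartAt E P).symm z))) = fun z ↦
      c • evalOrZero U s (φ ((chartAt E P).symm z)) := by
    funext z
    rw [evalOrZero_mul_pointwise, smul_eq_mul]
    by_cases hz : (φ ((chartAt E P).symm z)).pt ∈ U
    · rw [hκ, evalOrZero_const_res U c hz]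
    · rw [evalOrZero_of_not_mem s hz, evalOrZero_of_not_mem _ hz, mul_zero, mul_zero]
  rw [hfun]
  exact fderiv_const_smul (hasFDerivAt_evalOrZero_chart hφ P U s hU).differentiableAt c

omit [IsManifold 𝓘(ℂ, E) ω M] in
/-- **Subtracting the value**: the differential of the germ of `s - s(P)` is that of `s`, and that
germ lies in the maximal ideal. [cite: SerreGAGA1956, §2 n°5 Prop. 2] -/
theorem _root_.Literature.NumberTheory.Transcendental.IsAnalytification.stalkDifferential_sub_value (hφ : IsAnalytification E Y d φ) (P : M) {x : Y.left}
    (hx : (φ P).pt = x) (D : Y.left.presheaf.stalk x →+ (E →L[ℂ] ℂ))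
    (hD : ∀ (U : Y.left.Opens) (hU : x ∈ U) (s : Γ(Y.left, U)),
      D (Y.left.presheaf.germ U x hU s) =
        fderiv ℂ (fun z ↦ evalOrZero U s (φ ((chartAt E P).symm z))) (chartAt E P P))
    (U : Y.left.Opens) (hU : x ∈ U) (s : Γ(Y.left, U)) :
    let s₀ := s - Y.left.presheaf.map (homOfLE (le_top : U ≤ ⊤)).op
      (Y.hom.appTop ((Scheme.ΓSpecIso (.of ℂ)).inv (evalOrZero U s (φ P))))
    Y.left.presheaf.germ U x hU s₀ ∈ IsLocalRing.maximalIdeal (Y.left.presheaf.stalk x) ∧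
      D (Y.left.presheaf.germ U x hU s₀) =
        fderiv ℂ (fun z ↦ evalOrZero U s (φ ((chartAt E P).symm z))) (chartAt E P P) := by
  subst hx
  intro s₀
  refine ⟨?_, ?_⟩
  · rw [germ_mem_maximalIdeal_iff P rfl hU]
    have h := evalOrZero_add_pointwise U s₀
      (Y.left.presheaf.map (homOfLE (le_top : U ≤ ⊤)).op
        (Y.hom.appTop ((Scheme.ΓSpecIso (.of ℂ)).inv (evalOrZero U s (φ P))))) (φ P)
    rw [evalOrZero_const_res U _ hU, show s₀ + _ = s from sub_add_cancel _ _] at h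
    linear_combination -h
  · rw [hD]
    refine (Filter.EventuallyEq.fderiv_eq (f := fun z ↦
      evalOrZero U s (φ ((chartAt E P).symm z)) - evalOrZero U s (φ P)) ?_).trans
      (fderiv_sub_const _)
    filter_upwards [chart_preimage_mem_nhds' hφ P U hU] with z hz
    have hzU : (φ ((chartAt E P).symm z)).pt ∈ U := hz.2
    have h := evalOrZero_add_pointwise U s₀
      (Y.left.presheaf.map (homOfLE (le_top : U ≤ ⊤)).op
        (Y.hom.appTop ((Scheme.ΓSpecIso (.of ℂ)).inv (evalOrZero U s (φ P)))))
      (φ ((chartAt E P).symm z))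
    rw [evalOrZero_const_res U _ hzU, show s₀ + _ = s from sub_add_cancel _ _] at h
    exact eq_sub_of_add_eq h.symm

end StalkDifferential

/-! ### §3  The cotangent differential of a complex abelian variety -/

namespace AbelianVariety

open Literature.AlgebraicGeometry.Motives.AbelianVariety

section CotangentDifferential

variable {B : AbelianVariety ℂ}
  {E : Type*} [NormedAddCommGroup E] [NormedSpace ℂ E] [FiniteDimensional ℂ E]
  {M : Type*} [TopologicalSpace M] [ChartedSpace E M] [IsManifold 𝓘(ℂ, E) ω M]
  {φ : M → ComplexPoints B.X}

omit [FiniteDimensional ℂ E] in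
/-- `dim_ℂ E^* = dim_ℂ E` for continuous linear functionals on a finite-dimensional space. [folklore] -/
private theorem finrank_dual_clm [FiniteDimensional ℂ E] :
    Module.finrank ℂ (E →L[ℂ] ℂ) = Module.finrank ℂ E := by
  rw [← (LinearMap.toContinuousLinearMap : (E →ₗ[ℂ] ℂ) ≃ₗ[ℂ] (E →L[ℂ] ℂ)).finrank_eq]
  exact Subspace.dual_finrank_eq

/-- **The differential at the origin is an isomorphism `T_e^*(B) ≅ E^*`.**  For a complex abelian
variety `B`, an analytification `φ : M → B(ℂ)` with holomorphic atlas (model space `E`) and a point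
`P ∈ M` over the origin, there is a `ℂ`-linear isomorphism `Ψ₀` from the algebraic cotangent space
`𝔪_e/𝔪_e²` (`Cotangent B`) onto `E^* = Hom_ℂ(E, ℂ)` sending the class `d s` of a germ `s ∈ 𝔪_e` to the
differential at `χ P` of `z ↦ s(φ(χ⁻¹ z))`, `χ` the chart of `M` at `P` — Lange–Birkenhake §1.1.5 «the
complex cotangent space `Ω¹_{X,0}` of `X` at `0` is `Ω := Hom_ℂ(V, ℂ)`» for the ALGEBRAIC cotangent
space, via GAGA at a point (Serre §2 n°6 Prop. 3 Cor. 2: `IsAnalytification.exists_rational_cotangentFrame`)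
and `dim 𝔪_e/𝔪_e² = dim B` (`finrank_cotangent`).
[cite: LangeBirkenhake1992, §1.1.5 (before Lemma 1.1.22) and §1.1.2 Corollary 1.1.7]
[cite: SerreGAGA1956, §2 n°6 Prop. 3 Cor. 2] [cite: Shimura1998, §2.6 Proposition 3] -/
theorem exists_cotangentDifferential_of_isAnalytification (hφ : IsAnalytification E B.X B.dim φ)
    (P : M) (hP : (φ P).pt = origin B) :
    ∃ Ψ₀ : Cotangent B ≃ₗ[ℂ] (E →L[ℂ] ℂ),
      ∀ (U : B.X.left.Opens) (hU : origin B ∈ U) (s : Γ(B.X.left, U))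
        (hs : B.X.left.presheaf.germ U (origin B) hU s ∈
          IsLocalRing.maximalIdeal (stalkOrigin B)),
        Ψ₀ (Cotangent.mk B ⟨_, hs⟩) =
          fderiv ℂ (fun z ↦ evalOrZero U s (φ ((chartAt E P).symm z))) (chartAt E P P) := by
  classical
  haveI : SmoothOfRelativeDimension B.dim B.X.hom := B.smoothOfRelativeDimension_dim
  letI alg : Algebra ℂ (stalkOrigin B) := (stalkOriginAlgebraMap B).toAlgebra
  obtain ⟨D, hD⟩ := exists_stalkDifferential_of_eq hφ P hP
  -- the differential restricted to `𝔪_e`, `ℂ`-linear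
  let f : IsLocalRing.maximalIdeal (stalkOrigin B) →ₗ[ℂ] (E →L[ℂ] ℂ) :=
    { toFun := fun a ↦ D a
      map_add' := fun a b ↦ by rw [Submodule.coe_add, map_add]
      map_smul' := fun c a ↦ by
        rw [RingHom.id_apply, Submodule.coe_smul_of_tower, Algebra.smul_def]
        exact stalkDifferential_const_mul hφ P hP D hD c a }
  -- it kills products (Leibniz at a zero)
  have hf : ∀ a b : IsLocalRing.maximalIdeal (stalkOrigin B), f (a * b) = 0 := fun a b ↦
    stalkDifferential_mul_eq_zero hφ P hP D hD a.2 b.2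
  -- descend to `𝔪_e/𝔪_e²`
  let Ψ : Cotangent B →ₗ[ℂ] (E →L[ℂ] ℂ) := Ideal.Cotangent.lift f hf
  have hΨ : ∀ (U : B.X.left.Opens) (hU : origin B ∈ U) (s : Γ(B.X.left, U))
      (hs : B.X.left.presheaf.germ U (origin B) hU s ∈ IsLocalRing.maximalIdeal (stalkOrigin B)),
      Ψ (Cotangent.mk B ⟨_, hs⟩) =
        fderiv ℂ (fun z ↦ evalOrZero U s (φ ((chartAt E P).symm z))) (chartAt E P P) := by
    intro U hU s hs
    exact (Ideal.Cotangent.lift_toCotangent f hf ⟨_, hs⟩).trans (hD U hU s)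
  -- onto: the differentials of regular functions span `E^*` (GAGA at a point)
  have hsurj : Function.Surjective Ψ := by
    obtain ⟨ℓ, -, hspan, hℓ, -⟩ := exists_rational_cotangentFrame (k := ℂ) hφ (P := P)
      (fun U hU s ↦ ⟨(φ P).eval U hU s, by rw [Algebra.algebraMap_self, RingHom.id_apply]⟩)
    rw [← LinearMap.range_eq_top, eq_top_iff]
    refine hspan.trans (Submodule.span_le.2 ?_)
    rintro _ ⟨i, rfl⟩
    obtain ⟨U, s, hPU, hDs⟩ := hℓ i
    have hU : origin B ∈ U := hP ▸ hPU
    obtain ⟨hmem, hval⟩ := stalkDifferential_sub_value hφ P hP D hD U hU s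
    have hmem' : B.X.left.presheaf.germ U (origin B) hU _ ∈
        IsLocalRing.maximalIdeal (stalkOrigin B) := hmem
    refine ⟨Cotangent.mk B ⟨_, hmem'⟩, ?_⟩
    rw [hΨ U hU _ hmem', ← hD U hU, hval, hDs.fderiv]
  -- dimensions: `dim 𝔪_e/𝔪_e² = dim B = dim E = dim E^*`
  have hfin : Module.finrank ℂ (Cotangent B) = Module.finrank ℂ (E →L[ℂ] ℂ) := by
    rw [finrank_cotangent, finrank_dual_clm, hφ.finrank_eq]
  have hinj : Function.Injective Ψ :=
    (LinearMap.injective_iff_surjective_of_finrank_eq_finrank hfin).2 hsurj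
  exact ⟨LinearEquiv.ofBijective Ψ ⟨hinj, hsurj⟩, hΨ⟩

end CotangentDifferential

/-! ### §4  The torus uniformisation: analytic representation of an endomorphism, and the torus form -/

section Torus

variable {B : AbelianVariety ℂ} {ι : Type} [Fintype ι]
  {Φ : (ι → ℝ) ≃L[ℝ] (Fin B.dim → ℂ)} {φ : ComplexTorus Φ → ComplexPoints B.X}

omit [Fintype ι] in
/-- A uniformisation compatible with the group laws sends `0` to the unit point. [folklore] -/
private theorem apply_zero_eq_one (hφadd : ∀ x y, φ (x + y) = φ x * φ y) : φ 0 = 1 := by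
  have h00 := hφadd 0 0
  rw [add_zero] at h00
  exact mul_eq_left.mp h00.symm

omit [Fintype ι] in
/-- … hence `0` lies over the origin `e` of `B`. [folklore] -/
private theorem pt_apply_zero (hφadd : ∀ x y, φ (x + y) = φ x * φ y) : (φ 0).pt = origin B := by
  rw [apply_zero_eq_one hφadd]
  exact one_left_base _

/-- **(T2-0) Analytic representation of an algebraic endomorphism.**  For the torus uniformisation
`φ : E/Φ(ℤ^ι) → B(ℂ)` (an analytification compatible with the group laws) and an endomorphism `g` of
`B`, the transport `φ⁻¹ ∘ g(ℂ) ∘ φ` is holomorphic (GAGA, functoriality: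
`IsAnalytification.mdifferentiable_comp_map_holds`) and fixes `0`, hence (Lange–Birkenhake
Prop. 1.1.6, `ComplexTorus.exists_eq_mapMatrix_of_map_zero`) is the homomorphism `mapMatrix A` of an
integer matrix `A` (the rational representation) whose analytic representation `L = Φ ∘ A_ℝ ∘ Φ⁻¹`
is `ℂ`-LINEAR. [cite: LangeBirkenhake1992, §1.1.2 Proposition 1.1.6 and Corollary 1.1.7]
[cite: SerreGAGA1956, §2 n°5 (fonctorialité de X^h)] -/
theorem analyticRep_of_hom (hφ : IsAnalytification (Fin B.dim → ℂ) B.X B.dim φ)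
    (hφadd : ∀ x y, φ (x + y) = φ x * φ y) (g : B ⟶ B) :
    ∃ (A : Matrix ι ι ℤ) (L : (Fin B.dim → ℂ) →L[ℂ] (Fin B.dim → ℂ)),
      (∀ x : ι → ℝ, Φ ((A.map (Int.cast : ℤ → ℝ)).mulVec x) = L (Φ x)) ∧
      ∀ t, φ (ComplexTorus.mapMatrix Φ Φ A t) = AlgPoints.map g.hom.hom.hom (φ t) := by
  haveI : SmoothOfRelativeDimension B.dim B.X.hom := B.smoothOfRelativeDimension_dim
  -- the transport `h = φ⁻¹ ∘ g(ℂ) ∘ φ` of `g` to the torus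
  set h : ComplexTorus Φ → ComplexTorus Φ := fun t ↦
    hφ.homeomorph.symm (AlgPoints.map g.hom.hom.hom (φ t)) with hdef
  have hh : φ ∘ h = AlgPoints.map g.hom.hom.hom ∘ φ :=
    funext fun t ↦ hφ.homeomorph.apply_symm_apply _
  -- GAGA (functoriality): `h` is holomorphic
  have hhol : MDifferentiable 𝓘(ℂ, Fin B.dim → ℂ) 𝓘(ℂ, Fin B.dim → ℂ) h :=
    IsAnalytification.mdifferentiable_comp_map_holds hφ hφ g.hom.hom.hom h hh
  -- `h 0 = 0`: `φ 0 = 1` and `g(ℂ) 1 = 1`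
  have hφ0 : φ 0 = 1 := apply_zero_eq_one hφadd
  have h0 : h 0 = 0 := by
    change hφ.homeomorph.symm (AlgPoints.map g.hom.hom.hom (φ 0)) = 0
    rw [hφ0, AlgPoints.map_apply, MonObj.one_comp, ← hφ0]
    exact hφ.homeomorph.symm_apply_apply 0
  -- Lange–Birkenhake Prop. 1.1.6
  obtain ⟨A, L, hAL, -, hhA⟩ := ComplexTorus.exists_eq_mapMatrix_of_map_zero hhol h0
  refine ⟨A, L, hAL, fun t ↦ ?_⟩
  have ht := congrFun hh t
  rw [Function.comp_apply, Function.comp_apply, hhA] at ht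
  exact ht

/-- **(T2-a/b) The differential at the origin, torus form.**  For the torus uniformisation
`φ : E/Φ(ℤ^ι) → B(ℂ)` of a complex abelian variety (`E = ℂ^{dim B}`), compatible with the group laws:
a `ℂ`-linear isomorphism `Ψ₀ : T_e^*(B) = 𝔪_e/𝔪_e² ≃ E^*` with `Ψ₀ (d s) =` the differential at `χ 0`
of `z ↦ s(φ(χ⁻¹ z))`, `χ` the chart of the torus at `0` (Lange–Birkenhake §1.1.5: `Ω¹_{X,0} = Hom_ℂ(V,ℂ)`).
[cite: LangeBirkenhake1992, §1.1.5 (before Lemma 1.1.22) and §1.1.2 Corollary 1.1.7]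
[cite: SerreGAGA1956, §2 n°6 Prop. 3 Cor. 2] -/
theorem exists_cotangentDifferential (hφ : IsAnalytification (Fin B.dim → ℂ) B.X B.dim φ)
    (hφadd : ∀ x y, φ (x + y) = φ x * φ y) :
    ∃ Ψ₀ : Cotangent B ≃ₗ[ℂ] ((Fin B.dim → ℂ) →L[ℂ] ℂ),
      ∀ (U : B.X.left.Opens) (hU : origin B ∈ U) (s : Γ(B.X.left, U))
        (hs : B.X.left.presheaf.germ U (origin B) hU s ∈
          IsLocalRing.maximalIdeal (stalkOrigin B)),
        Ψ₀ (Cotangent.mk B ⟨_, hs⟩) =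
          fderiv ℂ (fun z : Fin B.dim → ℂ ↦ evalOrZero U s
            (φ ((chartAt (Fin B.dim → ℂ) (0 : ComplexTorus Φ)).symm z)))
            (chartAt (Fin B.dim → ℂ) (0 : ComplexTorus Φ) 0) :=
  exists_cotangentDifferential_of_isAnalytification hφ 0 (pt_apply_zero hφadd)

end Torus

end AbelianVariety

end Literature.AlgebraicGeometry.HodgeTheory

end
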